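import Mathlib
import HarnessLib
import HarnessLib.Audit
import Summits.AtomisticToContinuum.Statement
import HarnessLib.Audit.Status.Attr

/-!
Route: BECDensityChord

DORMANT since 2026-08-22T16:54:32Z (reconciler: no traction for 5.5 d (last activity item-evidence-added at 2026-08-17T04:19:12Z); parked, not closed — `ledger route dormant route-AtomisticToContinuum-BECDensityChord --off` to reactivat) — unstaffed, not closed; items shared with open routes are served there. `ledger route dormant <id> --off` reactivates.

# Route BECDensityChord — one secant from infinite dilution — star-shaped depletion in ρ^(1/3) at
fixed N (parent: concavity of λ_max) carries the free dilution anchor to every dilute density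

It suffices to show X = DensityChordBEC: for every repulsive finite-range radial v there is ρ⋆ =
ρ⋆(v) > 0 such that for all
large N (ONE threshold, uniform in the density) and every 0 < ρ ≤ ρ⋆ the largest eigenvalue of the
one-particle density matrix of the
N-particle Dirichlet ground state in the box of side (N/ρ)^(1/3) obeys λ_max ≥ (1 − (ρ/ρ⋆)^(1/3))·N
— the conjunct with the explicit
constant c(ρ) = 1 − (ρ/ρ⋆)^(1/3), i.e. the CHORD in the variable t := ρ^(1/3) (inverse interparticle
distance) from the infinitely dilute
endpoint (t = 0, complete condensation at fixed N) to the edge ρ⋆ of the dilute window (where only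
λ_max ≥ 0 is used). X follows in one
line from the spine crux DepletionStarShaped (the depletion D_N(t) := 1 − λ_max/N is star-shaped
from the anchor: D_N(t)/t non-decreasing
on (0, t⋆]), and that in turn from its structural parent DensityConcavity (t ↦ λ_max concave) plus
the provable DilutionAnchor.
Cards realised: density-chord-dilution-anchor-v2 (spine; SS/DC/anchor/K3 exactly as carded),
density-chord-dilution-anchor (v1, superseded by v2).
Lean: `∀ v : ℝ → ENNReal,
Literature.MathematicalPhysics.QuantumManyBody.BoseGas.IsRepulsiveFiniteRange v → ∃ ρs : ℝ, 0 < ρs ∧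
∀ᶠ N : ℕ in Filter.atTop, ∀ ρ : ℝ, 0 < ρ → ρ ≤ ρs → ENNReal.ofReal ((1 - (ρ / ρs) ^ (1 / 3 : ℝ)) *
N) ≤ Literature.MathematicalPhysics.QuantumManyBody.BoseGas.condensateNumber v N
(Literature.MathematicalPhysics.QuantumManyBody.BoseGas.sideLength ρ N)`

## Assembly
Pure logic plus one line of real arithmetic, PROVED sorry-free in glue.lean / Sketch.lean (`theorem
closes (hSS : DepletionStarShaped)
(hSL : SecantLemma) : BoseEinsteinCondensation`): X := hSL hSS gives ρ⋆ and an eventual-in-N bound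
uniform in ρ ≤ ρ⋆; for the conjunct
take ρ₀ := ρ⋆ and, for 0 < ρ < ρ⋆, c := 1 − (ρ/ρ⋆)^(1/3) > 0 (Real.rpow_lt_one) and the same
eventual set (Filter mono). The parent path
DensityConcavity → DilutionAnchor → (ConcavityToSecant) DepletionStarShaped feeds the same theorem;
BogoliubovDepletionConvex is the
off-spine necessary condition / periodic limit curve. `BoseEinsteinCondensation` is the sub-problem
Statement decl by name (root abbrev of
Literature.MathematicalPhysics.QuantumManyBody.BoseGas.BoseEinsteinCondensation).

Rationale: WHY THIS LINE. Mechanism (cards density-chord-dilution-anchor, -v2): at FIXED N the dilute end of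
the density axis is trivial in d = 3 — diluting the box
switches the interaction off (coupling aρ^(1/3) → 0; by `condensateNumber_dilate`, in tree, the
density family at fixed N IS the
range-dilation family t⁻²v(·/t) in a fixed box, hard cores included), so f_N := λ_max/N → 1: an
exact ANCHOR that is false in d = 1
(Tonks–Girardeau endpoint, Girardeau1960/Lenard1964 = the witness of
Literature.Barriers.AtomisticToContinuum.OneDimensionalHardCore).
A SHAPE of t ↦ f_N(t³) then transports the anchor to finite density by a chord, exactly as
Griffiths–Hurst–Sherman transport an order
parameter along the field once concavity is known (GriffithsHurstSherman1970; concave & f(0) = 0 ⇒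
star-shaped ⇒ superadditive,
Bruckner–Ostrow 1962 doi:10.2140/pjm.1962.12.1203) — here the shape itself is the conjecture and the
weakest one giving the chord
(star-shaped depletion, 'elasticity ≥ 1') is the spine. Why the variable and the dimension are
forced: each Bogoliubov occupation
v_k² = φ(x), φ(x) = (1+x)/(2√(1+2x)) − ½, x = 8πaρ/k², is convex in the coupling while particle-like
(x < 1) and concave once
phonon-like; summed with the d-dimensional density of states the curvature sign is
B((4−d)/2,(1+d)/2) − ½B((6−d)/2,(d−1)/2) = +, 0, −∞
for d = 3, 2, 1, and in t = ρ^(1/3) the bulk law 1 − f = (8/3√π)(at)^(3/2)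
(LiebSeiringerSolovejYngvason2005 Ch. 2/5; measured
doi:10.1103/physrevlett.119.190404; DMC GiorginiBoronatCasulleras1999) is concave with elasticity
3/2, the fixed-N onset
1 − f_N = (Z/π²)a²N^(1/3)t² has elasticity 2, and in the Gross–Pitaevskii window the exact N → ∞
torus curve N(1 − f_N) → D(κ) =
Σ_(n≠0) φ(2κ/π|n|²), κ = aN/L (BoccatoEtAl2019Acta eq. (1.11), verified p. 4) is convex with
elasticity ∈ [1.52, 2] (computed on the
cards and re-run here). Imported: correlation-inequality chord architecture (statistical mechanics
of ferromagnets) + Bogoliubov/BBCS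
finite-volume theory as evidence and falsifier, nothing as hypothesis. What it does that no open
route does: it is second- /secant-order in
the DENSITY from a free endpoint (BECTorusUnfolding's V2, retired, was first-order in L and needed
BEC at one density; the RP/KLS,
pinning, Jastrow and sum-rule lines use a deep anchor, a source, a gap or an energy resolution —
this line uses none: no gap × length²
bookkeeping, no susceptibility, number-conserving, cubes only, conclusion = λ_max itself).

RANKED CRUXES. #0 DensityChordBEC (target) — X as in § Thesis: ∀ v repulsive finite-range ∃ ρ⋆ > 0
∀ᶠ N ∀ 0 < ρ ≤ ρ⋆: ofReal((1 − (ρ/ρ⋆)^(1/3))·N) ≤ condensateNumber v N (sideLength ρ N). (why it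
might fail: it is BEC-strength with an explicit profile: any v whose condensate fraction dips below
the chord somewhere in every (0, ρ⋆] at arbitrarily large N (e.g. a non-monotone finite-size
crossover) refutes this form though not the conjunct.) [LiebSeiringerSolovejYngvason2005,
BoccatoEtAl2019Acta, GiorginiBoronatCasulleras1999]
#2 DepletionStarShaped (crux) — (card v2 K1, SS) ∀ v ∃ ρ⋆ > 0 ∀ᶠ N ∀ 0 < ρ₁ ≤ ρ₂ ≤ ρ⋆: ρ₂^(1/3)·N +
ρ₁^(1/3)·cN(ρ₂) ≤ ρ₁^(1/3)·N + ρ₂^(1/3)·cN(ρ₁), cN(ρ) := condensateNumber v N (sideLength ρ N) —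
i.e. the depletion per unit t, (1 − f_N)/ρ^(1/3), is non-decreasing on (0, ρ⋆] at every large N, the
N-threshold uniform in the densities (subtraction-free ℝ≥0∞ form; cN ≤ N by Bessel). [difficulty:
open-problem] (why it might fail: N-uniform LOWER bound on a first-order response (t∂_t D_N ≥ D_N;
∂_t along the dilation family is a pair-virial/contact correlator) with no sign principle beyond
Bogoliubov; the crossover κ = aN^(2/3)ρ^(1/3) ∈ [1,10²] is certified only by the TORUS Bogoliubov
curve, Dirichlet walls uncomputed.) [BoccatoEtAl2019Acta, LiebSeiringerSolovejYngvason2005,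
GiorginiBoronatCasulleras1999, arXiv:2011.10869, arXiv:1309.7326]
#3 DensityConcavity (crux) — (cards K1/K2, DC — the structural parent) ∀ v ∃ ρ⋆ > 0 ∀ᶠ N ∀ 0 < ρ₀ ≤
ρ ≤ ρ₁ ≤ ρ⋆: (ρ₁^(1/3) − ρ^(1/3))·cN(ρ₀) + (ρ^(1/3) − ρ₀^(1/3))·cN(ρ₁) ≤ (ρ₁^(1/3) −
ρ₀^(1/3))·cN(ρ), i.e. t ↦ λ_max at density t³ is concave on (0, ρ⋆^(1/3)] at every large N
(three-point form, one threshold for all triples). With DilutionAnchor it implies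
DepletionStarShaped (ConcavityToSecant). [difficulty: open-problem] (why it might fail: no sign
principle for a second derivative of a ground-state expectation along a dilation family (third-order
response); a non-concave blip of width → 0 in the GP→bulk crossover breaks N-uniformity while SS
survives; soft v re-condense at high density (CHJL 2021): ρ⋆ below an inflection.)
[BoccatoEtAl2019Acta, LiebSeiringerSolovejYngvason2005, GriffithsHurstSherman1970, arXiv:2011.10869,
doi:10.1016/0375-9601(92)90381-u]
#4 BogoliubovDepletionConvex (crux) — (cards K3a) the Gross–Pitaevskii-window depletion lattice sum
D(κ) = Σ_(n ∈ ℤ³∖0) φ(2κ/(π|n|²)), φ(x) = (1+x)/(2√(1+2x)) − ½ (= Σ_p v_p² of BBCS (1.11) on the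
unit torus, p = 2πn, 𝔞₀ = κ), is convex on [0, ∞). By BBCS it is the exact N → ∞ limit of N(1 − f_N)
along κ = aN/L fixed (periodic b.c.), so its convexity (⇒ star-shape, D(0) = 0) is the necessary
condition for the periodic twin of ranks 2–3 and the computable content of the 'curvature budget'.
[difficulty: M] (why it might fail: only the FULL sum is convex (any truncation turns concave once
every kept mode is phonon-like, κ > πR²/2): the proof must control the UV tail and lattice-point
fluctuations at intermediate κ; D'' > 0 is scanned (71 log points on [10⁻³,10⁴] here, 1%-steps on
[0.02,80] on the card), not certified.) [BoccatoEtAl2019Acta, LiebSeiringerSolovejYngvason2005,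
MoraCastin2003]
#9 DilutionAnchor (support) — (cards K2/P0; provable now, the formal carrier of d = 3) ∀ v ∀ᶠ N ∀ ε
> 0 ∃ ρ₁ > 0 ∀ 0 < ρ < ρ₁: ofReal((1 − ε)·N) ≤ cN(ρ). Proof route: v ≥ 0 ⇒ ⟨Ψ, H_free Ψ⟩ ≤ energy ≤
E₀ + δ; E₀ ≤ 3π²N/L² + C(N, v)/L³ by a C¹ trial state (smoothed ∏ sin(πx/L) × range-avoiding Jastrow
factor, hard cores and non-integrable v included); sine-series Parseval on the cube gives ∫|∇Ψ|² ≥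
(3π²N/L²)·1 + (3π²/L²)·(1 − |⟨Φ₀,Ψ⟩|²), Φ₀ = the free Dirichlet ground state; so 1 − |⟨Φ₀,Ψ⟩|² ≤
(C/L³ + δ)L²/3π² → 0, and maxOccupation ≥ occupation of the ground mode ≥ N|⟨Φ₀,Ψ⟩|² (Jensen in the
other N − 1 variables); conclude with le_condensateNumber. False in d = 1 (Tonks: λ_max ≈ 1.54√N),
marginal in d = 2. [difficulty: L] [LiebSeiringerSolovejYngvason2005, Dyson1957, Girardeau1960,
Lenard1964, ForresterFrankelGaroni2003]
#9 SecantLemma (support) — DepletionStarShaped → DensityChordBEC. Proof: fix v, take ρ⋆ and the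
eventual N from SS; for 0 < ρ ≤ ρ⋆ apply SS to (ρ, ρ⋆), drop the term ρ^(1/3)·cN(ρ⋆) ≥ 0: ρ⋆^(1/3)·N
≤ ρ^(1/3)·N + ρ⋆^(1/3)·cN(ρ); if cN(ρ) = ⊤ the goal is trivial, else pass to reals and divide by
ρ⋆^(1/3) > 0, using (ρ/ρ⋆)^(1/3) = ρ^(1/3)/ρ⋆^(1/3) (Real.div_rpow). No anchor and no bound cN ≤ N
are needed. [difficulty: provable-now] [GriffithsHurstSherman1970, doi:10.2140/pjm.1962.12.1203]
#9 ConcavityToSecant (support) — DensityConcavity → DilutionAnchor → DepletionStarShaped (concave +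
anchored at the free end ⇒ star-shaped depletion; Bruckner–Ostrow). Proof: same ρ⋆ as DC; intersect
the two eventual sets in N; given 0 < ρ₁ ≤ ρ₂ ≤ ρ⋆, if cN(ρ₁) = ⊤ done; else for ε > 0 and 0 < ρ₀ <
min(ρ₁, ρ₁(ε, N)) apply DC to (ρ₀, ρ₁, ρ₂), bound cN(ρ₀) below by ofReal((1 − ε)N), pass to reals
(finiteness of cN(ρ₂) follows from the inequality itself or is bypassed by `le_top` cases) and let
ρ₀ → 0, ε → 0 (continuity of r ↦ r^(1/3) at 0): ρ₂^(1/3)·N + ρ₁^(1/3)·cN(ρ₂) ≤ ρ₁^(1/3)·N +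
ρ₂^(1/3)·cN(ρ₁). [difficulty: provable-now] [doi:10.2140/pjm.1962.12.1203,
GriffithsHurstSherman1970]

TWO-LAYER PLAN. Foreseen glued splits (k ≤ 3, depth 1; nothing filed now). DepletionStarShaped ⇐
SSOnset → SSWindow → SSBulk → DepletionStarShaped by
REGIME in κ = aN^(2/3)ρ^(1/3): onset κ ≤ κ₀ (finite-N second-order perturbation theory with
remainder, elasticity 2 − O(κ)), window
κ₀ ≤ κ ≤ κ₁ (Bogoliubov/BBCS-type norm approximation of the Dirichlet ground state, C¹-in-κ, +
BogoliubovDepletionConvex or its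
Dirichlet analogue), bulk κ ≥ κ₁ at ρ ≤ ρ⋆ (the residual open problem: an N-uniform secant
inequality at fixed small density — where
localisation / second-order-energy technology, Fournais2020, FournaisSolovej2020, would have to be
made to speak about t∂_t of the
depletion rather than the energy); glue = the three regimes overlap for large N. DensityConcavity
splits the same way. BogoliubovDepletionConvex
⇐ SmallKappa (D'' ≥ 2Z/π² − Cκ) → LargeKappa (D'' = (3/4)(8/3√π)κ^(−1/2)(1 + O(κ^(−1/2))) via
Poisson summation with the |y|⁻¹ singularity
split off) → MidKappaIntervalArithmetic → BogoliubovDepletionConvex. DilutionAnchor ⇐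
FreeGapDirichlet (sine-series Poincaré with the
second level) → FixedNTrialState (E₀ ≤ 3π²N/L² + C/L³) → DilutionAnchor.

KILL CRITERIA. ¬DepletionStarShaped with a witness at arbitrarily large N and arbitrarily small ρ⋆
closes the route `refuted:DepletionStarShaped` — UNLESS
the witness is a Dirichlet-wall effect (elasticity < 1 from boundary layers at κ = O(1) while the
torus curve stays star-shaped): then PIVOT
to the periodic twin (same secant for the zero-mode occupation `condensateOccupation` of periodic
near-minimisers, where BBCS (1.11) makes the
window exact, + the shared boundary-transfer item stmt-AtomisticToContinuum-0827
BoundaryTransferWeak) by `route edit` with new items, not by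
rewording. ¬DensityConcavity alone: drop DC and ConcavityToSecant (`--drop`, not load-bearing; SS
survives a thin non-concave blip).
¬BogoliubovDepletionConvex: if D is still star-shaped (D/κ monotone) restate rank 4 as that; if even
D/κ decreases somewhere, SS is false on
the torus at every large N by BBCS — close `refuted` unless the Dirichlet census says otherwise.
¬DilutionAnchor cannot happen in d = 3 (if it
is 'refuted' the statement was mis-typed: repair). DensityChordBEC refuted for some admissible v (a
genuine dip below every chord at large N)
kills this explicit-constant line but not the conjunct: close and hand the witness to the numerics
cards. BoseEinsteinCondensation proved
elsewhere moots the route; PeriodicBEC (stmt-0826) + 0827 proved elsewhere moots it too.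

NOT DECOMPOSED YET. Deliberately NOT filed at open: the regime split of SS/DC (above: it is layer 2
after a crux moves); the BBCS identification of the window
curve as a named Literature fact (BoccatoEtAl2019Acta (1.11) is printed for the TORUS and soft L³
potentials; its Dirichlet-box analogue —
Bogoliubov theory around the GP minimiser of the hard-wall cube, cf. BrenneckeSchleinSchraven2022
for traps, NamRougerieSeiringer2016 — is
not in print; vending either would put an unproved fact in the cone, and neither is on the spine);
the Beta-function trichotomy and
'concave in ρ^α iff α ≤ ½' (card P2: bookkeeping, Mathlib Beta/Gamma); the Bessel bound
condensateNumber ≤ N and finiteness lemmas (helper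
lemmas a prover attaches with --supports); the value of ρ⋆ (any ρ⋆ below the first inflection, ρ⋆a³
≲ 10⁻² expected; CHJL's
condensate-fraction minimum for soft v is the ceiling); the N-direction test family (N = 1 anchor at
fixed box, f concave in N^(1/3)) — a
falsifier, not an item; periodic/Neumann variants (pivot material, see Kill criteria).

CHEAPEST FALSIFIER. (0) RUN here (compute/bog_convexity2.py, pure python, smooth radial cutoff R =
40 and R = 28 agreeing to 6 digits + continuum tail): the
torus window curve has D''(κ) > 0 at all 71 log-grid points κ ∈ [10⁻³, 10⁴]; D''√κ rises from 0.106
(κ = 10⁻³, where D'' → 2Z/π² = 3.35)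
to 1.249 (κ ≈ 0.8) and tends to 1.1284 = (3/4)(8/3√π) (the LHY law) from κ ≈ 300 on; min D'' =
0.0113 at κ = 10⁴ — survives (the card's
1%-step scan of [0.02, 80]: min D'' = 0.137; elasticity κD′/D ∈ [1.52, 2]). (1) THE NEXT ONE, not
run: the Dirichlet census of card
dirichlet-box-bogoliubov-census — GP + Bogoliubov–de Gennes in the hard-wall cube, tabulating
D_Dir(κ) = N − λ_max for κ = aN/L ∈ [10⁻², 10³];
one κ-interval with d(D_Dir/κ)/dκ < 0 kills rank 2 at every large N (modulo the box analogue of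
BBCS), D_Dir'' < 0 kills rank 3 only.
(2) Published T = 0 DMC/PIGS condensate fractions (GiorginiBoronatCasulleras1999 Fig. 3;
Rossi–Salasnich arXiv:1309.7326 table) re-plotted
against (na³)^(1/3): one secant violation with both abscissae at na³ ≤ 10⁻². (3) The card's queued
few-body ED jobs (N ≤ 5, dense end) and the
N-direction family.

NUMBERS. Bulk Bogoliubov depletion 1 − f = (8/(3√π))(ρa³)^(1/2) = 1.5045 (ρa³)^(1/2) (elasticity 3/2
in t = ρ^(1/3); LiebSeiringerSolovejYngvason2005,
measured doi:10.1103/physrevlett.119.190404, DMC to na³ ≈ 10⁻³ GiorginiBoronatCasulleras1999).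
Fixed-N onset: 1 − f_N = (Z/π²)a²N^(1/3)t² + O(t³),
Z = Σ_(n≠0)|n|⁻⁴ = 16.532 (2Z/π² = 3.350 = D''(0+), reproduced here: 3.344 at κ = 10⁻³). GP window
(torus, BoccatoEtAl2019Acta (1.11), error
O(N^(−1/8)) on N(1 − f)): D(0.1) = 0.0154, D(1) = 1.075, D(10) = 42.06, D(100) = 1160.8 (this run);
D''√κ → 1.1284; elasticity 2 → 1.52 (κ ≈ 63)
→ 3/2 (card v2). Few-body ED (card, torus, N = 2, 3, 4, ρa³ ≤ 1.2·10⁻²): 90/90 second differences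
negative, log-elasticities ∈ [1.95, 2.17].
d = 1 contrast: λ_max ≈ 1.54√N at the dilution endpoint (OneDimensionalHardCore); window sum concave
for κ ≥ 2.82 (card). Expected ceiling:
ρ⋆a³ below the inflection preceding freezing/re-condensation, ~10⁻²–10⁻¹. Items at open: 8 (3
cruxes, 1 target, 3 support, 1 assembly).

DEFINITION REQUESTS. None. Everything is inlined over
Literature.MathematicalPhysics.QuantumManyBody.BoseGas.{IsRepulsiveFiniteRange, condensateNumber,
sideLength}
(lean search --decl: present in BoseEinsteinCondensation.lean) and Mathlib's ConvexOn / tsum /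
Real.sqrt; `condensateNumber_dilate`
(JelliumBoseGasCondensateDilation.lean) is proved in tree. A convenience `condensateFraction v N ρ
:= (condensateNumber v N (sideLength ρ N)).toReal / N`
is NOT requested (ℝ≥0∞ forms avoid truncated subtraction and junk at ⊤). Optional later cite fact
(not filed: off-spine, would be unproved in
the cone): BoccatoEtAl2019Acta eq. (1.11).

Novelty: Searches (2026-08-15, this seat; local searchd DOWN rc 75 for `lit search` all session — flagged):
`lit galaxy search --star all` ×4
("concave function of the density" 11 rows, textbooks, none on condensates; "concavity of the
condensate" 0; "condensate fraction decreases
monotonically" 0; "depletion of the condensate as a function of" 2: Fetter–Walecka, Pethick–Smith —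
the √(na³) law, no shape statement);
`lit frontier AtomisticToContinuum --since 2020` (30 rows; BEC descendants arXiv:2510.20493 kinetic
localisation, arXiv:2603.20776 Neumann
propagation of condensation, arXiv:2605.06844 trial states — none on shape in density); `lit bridges
AtomisticToContinuum --cross any` (one
Bose review arXiv:2209.11714, energies); `lit read arxiv:1801.01389` pp. 1–8 (eq. (1.11) verified);
`lean search` (condensateNumber_dilate,
eventually_groundStateEnergy_le_dyson, scatteringLength API found); plus the cards' searches
(crossref/zbMATH/arXiv/galaxy, 14 queries, listed
on the cards) and two refuter audits (audit-39 on v1, audit-37-g2 on v2) whose finds are adopted: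
Bruckner–Ostrow 1962 (concave ⇒ star-shaped),
CJL/CHJL 2021 (convexity in ρ of ENERGIES; condensate-fraction minimum at intermediate ρ for soft
v), Rossi–Salasnich arXiv:1309.7326 (PIGS n₀ table).
Nearest prior art found: GriffithsHurstSherman1970 doi:10.1063/1.1665211 + Griffiths 1967
doi:10.1063/1.1705219 (chord/secant transport of an
order parameter along the FIELD from an anchor where concavity is a theorem); Baumgartner 1  [refs: 10.1063/1.1665211, 10.1063/1.1705219, 10.1016/0375-9601(92, 2510.20493, 2603.20776, 2605.06844, 2209.11714, 1801.01389, 1309.7326, arxiv:1801.01389, doi:10.1063/1.1665211, doi:10.1063/1.1705219, doi:10.1016/0375-9601, GriffithsHurstSherman1970]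

Barriers (technique_class: concavity-in-density, chord-transport, dilution-anchor): - technique_class: concavity-in-density, chord-transport, dilution-anchor
- Literature.Barriers.AtomisticToContinuum.OneDimensionalHardCore: evaded by construction — the line
cannot even be stated in d = 1: its anchor (fixed-N dilution ⇒ free gas) IS the barrier's
Tonks–Girardeau witness there (λ_max ≈ 1.54√N at the t → 0 endpoint), so DilutionAnchor is false in
d = 1 and true (provable) in d = 3; the shape hypotheses also flip sign in d = 1 (window sum concave
for κ ≥ 2.82).
- Literature.Barriers.AtomisticToContinuum.PitaevskiiStringariOneDimension: same evasion; no
momentum distribution or sum rule is bounded — infrared physics enters only through the SIGN of a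
curvature/secant, which phonons lose to particle-like modes iff d > 2 (Beta identity, zero exactly
at d = 2).
- Literature.Barriers.AtomisticToContinuum.KineticGapLengthScales: not met on the spine — no gap ×
length² bookkeeping, no energy window; the free gap L⁻² is used only INSIDE DilutionAnchor at fixed
N (where N²a/L³ ≪ L⁻² is exactly the d = 3 dilution statement), never uniformly in N. Honest limit:
SS beyond the GP window is open; the bet is that an N-uniform secant SIGN is more accessible than an
asymptotic expansion, and it is testable at every finite N.
- Literature.Barriers.AtomisticToContinuum.EnergyAsymptoticsWithoutCondensation: respected — nothing
is inferred from energy asymptotics; the 1-D δ gas (Bogoliubov-exact energy, no BEC) violates both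
the anchor and the shape, so the line separates energy fro

History (route lifecycle, newest last):
- 2026-08-22T16:54:32Z · DORMANT — reconciler: no traction for 5.5 d (last activity item-evidence-added at 2026-08-17T04:19:12Z); parked, not closed — `ledger route dormant route-AtomisticToConti (operator:999:3720349)

sub-problem: BoseEinsteinCondensation · status: dormant · opened planner-plancard-AtomisticToContinuum-BoseEin-2c57c636-0 2026-08-15T18:23:26Z · rev 2 · ledger route-AtomisticToContinuum-BECDensityChord
GENERATED by the gate from the ledger (D-0016/17). Provers cite these decls: `theorem foo : Summit.AtomisticToContinuum.BoseEinsteinCondensation.Theses.BECDensityChord.<Decl> := …` in Summits/AtomisticToContinuum/BoseEinsteinCondensation/Theorems/<Name>.lean.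
-/

namespace Summit.AtomisticToContinuum.BoseEinsteinCondensation.Theses.BECDensityChord

open scoped BigOperators Topology Manifold Classical MeasureTheory ProbabilityTheory Matrix InnerProductSpace ComplexConjugate ContinuousMap
open Filter Set Function TopologicalSpace MeasureTheory

attribute [summit_statement] _root_.BoseEinsteinCondensation

/-- item stmt-AtomisticToContinuum-11553 · target · rank 0 · open · by planner
why it might fail: One N-threshold for all ρ ≤ ρ⋆ contains the thermodynamic limit at fixed ρ, where even λ_max ≥ cN is open (LSSY Ch. 5; Fournais2020 Thm 1.2 stops at L ≪ (ρa³)^(-1/4)(ρa)^(-1/2)); the explicit chord also dies on any finite-size dip of f_N below 1 − (ρ/ρ⋆)^(1/3) at large N.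
sources: LiebSeiringerSolovejYngvason2005, Fournais2020, BoccatoEtAl2019Acta, GiorginiBoronatCasulleras1999
[target] X as in § Thesis: ∀ v repulsive finite-range ∃ ρ⋆ > 0 ∀ᶠ N ∀ 0 < ρ ≤ ρ⋆: ofReal((1 −
(ρ/ρ⋆)^(1/3))·N) ≤ condensateNumber v N (sideLength ρ N). -/
@[route_item "route-AtomisticToContinuum-BECDensityChord"]
def DensityChordBEC : Prop :=
  ∀ v : ℝ → ENNReal, Literature.MathematicalPhysics.QuantumManyBody.BoseGas.IsRepulsiveFiniteRange v → ∃ ρs : ℝ, 0 < ρs ∧ ∀ᶠ N : ℕ in Filter.atTop, ∀ ρ : ℝ, 0 < ρ → ρ ≤ ρs → ENNReal.ofReal ((1 - (ρ / ρs) ^ (1 / 3 : ℝ)) * N) ≤ Literature.MathematicalPhysics.QuantumManyBody.BoseGas.condensateNumber v N (Literature.MathematicalPhysics.QuantumManyBody.BoseGas.sideLength ρ N)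

/-- item stmt-AtomisticToContinuum-11554 · crux · rank 2 · open · by planner
why it might fail: N-uniform SIGN of a first-order response (t∂ₜD_N ≥ D_N, t=ρ^(1/3)), no sign principle beyond Bogoliubov; at fixed ρ it contains thermodynamic-limit BEC, open (Fournais2020 Thm 1.2 stops at L ≪ (ρa³)^(-1/4)(ρa)^(-1/2)); κ∈[1,10²] crossover certified on the torus only (BBCS (1.11)), not Dirichlet.
sources: BoccatoEtAl2019Acta, LiebSeiringerSolovejYngvason2005, Fournais2020, CarlenEtAl2021, RossiSalasnich2013, GiorginiBoronatCasulleras1999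
[crux] (card v2 K1, SS) ∀ v ∃ ρ⋆ > 0 ∀ᶠ N ∀ 0 < ρ₁ ≤ ρ₂ ≤ ρ⋆: ρ₂^(1/3)·N + ρ₁^(1/3)·cN(ρ₂) ≤
ρ₁^(1/3)·N + ρ₂^(1/3)·cN(ρ₁), cN(ρ) := condensateNumber v N (sideLength ρ N) — i.e. the depletion
per unit t, (1 − f_N)/ρ^(1/3), is non-decreasing on (0, ρ⋆] at every large N, the N-threshold
uniform in the densities (subtraction-free ℝ≥0∞ form; cN ≤ N by Bessel). [difficulty: open-problem] -/
@[route_item "route-AtomisticToContinuum-BECDensityChord", crux]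
def DepletionStarShaped : Prop :=
  ∀ v : ℝ → ENNReal, Literature.MathematicalPhysics.QuantumManyBody.BoseGas.IsRepulsiveFiniteRange v → ∃ ρs : ℝ, 0 < ρs ∧ ∀ᶠ N : ℕ in Filter.atTop, ∀ ρ₁ ρ₂ : ℝ, 0 < ρ₁ → ρ₁ ≤ ρ₂ → ρ₂ ≤ ρs → ENNReal.ofReal (ρ₂ ^ (1 / 3 : ℝ)) * (N : ENNReal) + ENNReal.ofReal (ρ₁ ^ (1 / 3 : ℝ)) * Literature.MathematicalPhysics.QuantumManyBody.BoseGas.condensateNumber v N (Literature.MathematicalPhysics.QuantumManyBody.BoseGas.sideLength ρ₂ N) ≤ ENNReal.ofReal (ρ₁ ^ (1 / 3 : ℝ)) * (N : ENNReal) + ENNReal.ofReal (ρ₂ ^ (1 / 3 : ℝ)) * Literature.MathematicalPhysics.QuantumManyBody.BoseGas.condensateNumber v N (Literature.MathematicalPhysics.QuantumManyBody.BoseGas.sideLength ρ₁ N)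

/-- item stmt-AtomisticToContinuum-11555 · crux · rank 3 · open · by planner
why it might fail: Third-order response: no sign principle for ∂ₜ²λ_max along the dilation family; a thin non-concave blip in the GP→bulk crossover breaks the N-uniform 3-point form (SS survives); soft v: condensed fraction has a minimum at intermediate ρ (CHJL arXiv:2011.10869 §3.2) ⇒ ρ⋆ below the first inflection.
sources: CarlenEtAl2021, CarlenJauslinLieb2021, BoccatoEtAl2019Acta, LiebSeiringerSolovejYngvason2005, GriffithsHurstSherman1970, doi:10.1016/0375-9601(92)90381-u
[crux] (cards K1/K2, DC — the structural parent) ∀ v ∃ ρ⋆ > 0 ∀ᶠ N ∀ 0 < ρ₀ ≤ ρ ≤ ρ₁ ≤ ρ⋆: (ρ₁^(1/3)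
− ρ^(1/3))·cN(ρ₀) + (ρ^(1/3) − ρ₀^(1/3))·cN(ρ₁) ≤ (ρ₁^(1/3) − ρ₀^(1/3))·cN(ρ), i.e. t ↦ λ_max at
density t³ is concave on (0, ρ⋆^(1/3)] at every large N (three-point form, one threshold for all
triples). With DilutionAnchor it implies DepletionStarShaped (ConcavityToSecant). [difficulty:
open-problem] -/
@[route_item "route-AtomisticToContinuum-BECDensityChord"]
def DensityConcavity : Prop :=
  ∀ v : ℝ → ENNReal, Literature.MathematicalPhysics.QuantumManyBody.BoseGas.IsRepulsiveFiniteRange v → ∃ ρs : ℝ, 0 < ρs ∧ ∀ᶠ N : ℕ in Filter.atTop, ∀ ρ₀ ρ ρ₁ : ℝ, 0 < ρ₀ → ρ₀ ≤ ρ → ρ ≤ ρ₁ → ρ₁ ≤ ρs → ENNReal.ofReal (ρ₁ ^ (1 / 3 : ℝ) - ρ ^ (1 / 3 : ℝ)) * Literature.MathematicalPhysics.QuantumManyBody.BoseGas.condensateNumber v N (Literature.MathematicalPhysics.QuantumManyBody.BoseGas.sideLength ρ₀ N) + ENNReal.ofReal (ρ ^ (1 / 3 : ℝ) - ρ₀ ^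 (1 / 3 : ℝ)) * Literature.MathematicalPhysics.QuantumManyBody.BoseGas.condensateNumber v N (Literature.MathematicalPhysics.QuantumManyBody.BoseGas.sideLength ρ₁ N) ≤ ENNReal.ofReal (ρ₁ ^ (1 / 3 : ℝ) - ρ₀ ^ (1 / 3 : ℝ)) * Literature.MathematicalPhysics.QuantumManyBody.BoseGas.condensateNumber v N (Literature.MathematicalPhysics.QuantumManyBody.BoseGas.sideLength ρ N)

/-- item stmt-AtomisticToContinuum-11556 · support · rank 4 · open · by planner
why it might fail: only the FULL sum is convex (any truncation turns concave once every kept mode is phonon-like, κ > πR²/2): the proof must control the UV tail and lattice-point fluctuations at intermediate κ; D'' > 0 is scanned (71 log points on [10⁻³,10⁴] here, 1%-steps on [0.02,80] on the card), not certified.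
sources: BoccatoEtAl2019Acta, LiebSeiringerSolovejYngvason2005
[crux] (cards K3a) the Gross–Pitaevskii-window depletion lattice sum D(κ) = Σ_(n ∈ ℤ³∖0)
φ(2κ/(π|n|²)), φ(x) = (1+x)/(2√(1+2x)) − ½ (= Σ_p v_p² of BBCS (1.11) on the unit torus, p = 2πn, 𝔞₀
= κ), is convex on [0, ∞). By BBCS it is the exact N → ∞ limit of N(1 − f_N) along κ = aN/L fixed
(periodic b.c.), so its convexity (⇒ star-shape, D(0) = 0) is the necessary condition for the
periodic twin of ranks 2–3 and the computable content of the 'curvature budget'. [difficulty: M] -/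
@[route_item "route-AtomisticToContinuum-BECDensityChord"]
def BogoliubovDepletionConvex : Prop :=
  ConvexOn ℝ (Set.Ici (0 : ℝ)) (fun κ : ℝ => ∑' n : Fin 3 → ℤ, if n = 0 then (0 : ℝ) else ((1 + 2 * κ / (Real.pi * ∑ k : Fin 3, ((n k : ℝ)) ^ 2)) / (2 * Real.sqrt (1 + 2 * (2 * κ / (Real.pi * ∑ k : Fin 3, ((n k : ℝ)) ^ 2)))) - 1 / 2))

/-- item stmt-AtomisticToContinuum-11557 · support · rank 9 · open · by planner
sources: LiebSeiringerSolovejYngvason2005, Dyson1957, Girardeau1960, Lenard1964, ForresterFrankelGaroni2003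
[support] (cards K2/P0; provable now, the formal carrier of d = 3) ∀ v ∀ᶠ N ∀ ε > 0 ∃ ρ₁ > 0 ∀ 0 < ρ
< ρ₁: ofReal((1 − ε)·N) ≤ cN(ρ). Proof route: v ≥ 0 ⇒ ⟨Ψ, H_free Ψ⟩ ≤ energy ≤ E₀ + δ; E₀ ≤ 3π²N/L²
+ C(N, v)/L³ by a C¹ trial state (smoothed ∏ sin(πx/L) × range-avoiding Jastrow factor, hard cores
and non-integrable v included); sine-series Parseval on the cube gives ∫|∇Ψ|² ≥ (3π²N/L²)·1 +
(3π²/L²)·(1 − |⟨Φ₀,Ψ⟩|²), Φ₀ = the free Dirichlet ground state; so 1 − |⟨Φ₀,Ψ⟩|² ≤ (C/L³ + δ)L²/3π²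
→ 0, and maxOccupation ≥ occupation of the ground mode ≥ N|⟨Φ₀,Ψ⟩|² (Jensen in the other N − 1
variables); conclude with le_condensateNumber. False in d = 1 (Tonks: λ_max ≈ 1.54√N), marginal in d
= 2. [difficulty: L] -/
@[route_item "route-AtomisticToContinuum-BECDensityChord"]
def DilutionAnchor : Prop :=
  ∀ v : ℝ → ENNReal, Literature.MathematicalPhysics.QuantumManyBody.BoseGas.IsRepulsiveFiniteRange v → ∀ᶠ N : ℕ in Filter.atTop, ∀ ε : ℝ, 0 < ε → ∃ ρ₁ : ℝ, 0 < ρ₁ ∧ ∀ ρ : ℝ, 0 < ρ → ρ < ρ₁ → ENNReal.ofReal ((1 - ε) * N) ≤ Literature.MathematicalPhysics.QuantumManyBody.BoseGas.condensateNumber v N (Literature.MathematicalPhysics.QuantumManyBody.BoseGas.sideLength ρ N)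

/-- item stmt-AtomisticToContinuum-11558 · support · rank 9 · open · by planner
sources: GriffithsHurstSherman1970, doi:10.2140/pjm.1962.12.1203
[support] DepletionStarShaped → DensityChordBEC. Proof: fix v, take ρ⋆ and the eventual N from SS;
for 0 < ρ ≤ ρ⋆ apply SS to (ρ, ρ⋆), drop the term ρ^(1/3)·cN(ρ⋆) ≥ 0: ρ⋆^(1/3)·N ≤ ρ^(1/3)·N +
ρ⋆^(1/3)·cN(ρ); if cN(ρ) = ⊤ the goal is trivial, else pass to reals and divide by ρ⋆^(1/3) > 0,
using (ρ/ρ⋆)^(1/3) = ρ^(1/3)/ρ⋆^(1/3) (Real.div_rpow). No anchor and no bound cN ≤ N are needed.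
[difficulty: provable-now] -/
@[route_item "route-AtomisticToContinuum-BECDensityChord", crux]
def SecantLemma : Prop :=
  DepletionStarShaped → DensityChordBEC

/-- item stmt-AtomisticToContinuum-11559 · support · rank 9 · open · by planner
sources: doi:10.2140/pjm.1962.12.1203, GriffithsHurstSherman1970
[support] DensityConcavity → DilutionAnchor → DepletionStarShaped (concave + anchored at the free
end ⇒ star-shaped depletion; Bruckner–Ostrow). Proof: same ρ⋆ as DC; intersect the two eventual sets
in N; given 0 < ρ₁ ≤ ρ₂ ≤ ρ⋆, if cN(ρ₁) = ⊤ done; else for ε > 0 and 0 < ρ₀ < min(ρ₁, ρ₁(ε, N))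
apply DC to (ρ₀, ρ₁, ρ₂), bound cN(ρ₀) below by ofReal((1 − ε)N), pass to reals (finiteness of
cN(ρ₂) follows from the inequality itself or is bypassed by `le_top` cases) and let ρ₀ → 0, ε → 0
(continuity of r ↦ r^(1/3) at 0): ρ₂^(1/3)·N + ρ₁^(1/3)·cN(ρ₂) ≤ ρ₁^(1/3)·N + ρ₂^(1/3)·cN(ρ₁).
[difficulty: provable-now] -/
@[route_item "route-AtomisticToContinuum-BECDensityChord"]
def ConcavityToSecant : Prop :=
  DensityConcavity → DilutionAnchor → DepletionStarShaped

/-- item stmt-AtomisticToContinuum-11560 · assembly · rank 1 · open · by planner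
sources: LiebSeiringerSolovejYngvason2005, PenroseOnsager1956
[assembly] DepletionStarShaped → SecantLemma → BoseEinsteinCondensation (the deciding theorem
`closes` has exactly these two hypotheses). -/
@[route_item "route-AtomisticToContinuum-BECDensityChord"]
def Assembly : Prop :=
  DepletionStarShaped → SecantLemma → BoseEinsteinCondensation

/-! D-0027 §2.1 — DECIDING THEOREM (planner-authored via `route open/edit --closes-file`; by planner-plancard-AtomisticToContinuum-BoseEin-2c57c636-0 2026-08-15T18:23:27Z):
its hypotheses are this route's items and its conclusion the sub-problem Statement (glue_lint), and it elaborates with this file. -/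

@[closes "route-AtomisticToContinuum-BECDensityChord"] theorem closes (hSS : DepletionStarShaped) (hSL : SecantLemma) : BoseEinsteinCondensation := by
  intro v hv
  obtain ⟨ρs, hρs, hN⟩ := hSL hSS v hv
  refine ⟨ρs, hρs, fun ρ hρ hρlt => ?_⟩
  refine ⟨1 - (ρ / ρs) ^ (1 / 3 : ℝ), ?_, ?_⟩
  · have h1 : (ρ / ρs) ^ (1 / 3 : ℝ) < 1 :=
      Real.rpow_lt_one (div_nonneg hρ.le hρs.le) ((div_lt_one hρs).2 hρlt) (by norm_num)
    linarith
  · filter_upwards [hN] with N hN'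
    exact hN' ρ hρ hρlt.le

end Summit.AtomisticToContinuum.BoseEinsteinCondensation.Theses.BECDensityChord
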